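import Literature.NumberTheory.Rogawski1990.ArchBouazizStableFamily      -- ★ p849717 (D2-P3): `stOrbFamH`, `stOrbFamH_of_mem_regS`; brings `chartOrbH`, `endoTorus`, `stableSum`, `flipSet`, `archRH`, `RegS`, `ArchSmooth₂`
import Literature.NumberTheory.Rogawski1990.ArchBouazizClassMap          -- ★ p851469 (LH10-p01 (g5), SURJ binder): `bzClassMap`, `BzLocalized`, `bzClassMap_flipSet`, `continuous_bzClassMap`
import Literature.NumberTheory.Rogawski1990.ArchSmoothAmbientLift         -- ★ `exists_contDiff_hasCompactSupport_of_isArchSmooth` (ambient `C^∞` lift of an `IsArchSmooth` witness)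
import Literature.NumberTheory.Rogawski1990.ArchEndoscopicProductTestFunction  -- ★ (N1): `coe_endoEmbArch_eq`, `snd_coe_fst_apply`, `snd_coe_snd_apply`, `contDiff_apply_snd_apply`
import HarnessLib

/-!
# The CLASS-FUNCTION MULTIPLIER on `H_∞ = U(Φ₂)(L ⊗ ℝ) × U(Φ₁)(L ⊗ ℝ)`: `fH ↦ (F ∘ cl_H) · fH` preserves `C_c^∞(H_∞)` and multiplies the stable orbital family by
# `F ∘ bzClassMap S` on every regular set (Bouaziz 1994 §2.3, §5.1; Varadarajan 1989 §6 p. 229)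

Topic `NumberTheory/Rogawski1990`; namespace `Literature.NumberTheory.Rogawski1990`.  Definitions WITH BODIES and theorems (no instance, no notation, no axiom, no named
fact, no `sorry`).  Cell `pub/hodgecm-mathlib`, crux H413 (`stmt-HodgeConjecture-24833`), line LH3 (closer stub `stub_N9`, DIRECT ROAD), letter L3′ SURJ-OF-FORWARD road
(RULING #22∕#23, LH3-plan (g4)); binder∕assembler of record LH10-p01 (g5), S-ROAD CENSUS v1 piece **(Σ4) REGULAR GERMS**, sub-brick **(Σ4a) «MULTIPLIER»** (LH10-p01 (g5)
2026-09-02T12:38:43Z).  Author F0P3a-p04 (g25).  Count-neutral.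

THE POINT.  Surjectivity of `fH ↦ stOrbFamH L νH fH` onto Bouaziz's space near a REGULAR base class is proved by the «class-function multiplier» road: ONE test function
`β ∈ C_c^∞(H_∞)` whose stable family does not vanish near the base class, multiplied by a smooth CLASS function `F ∘ cl_H` (`cl_H : H_∞ → (W → ℂ × ℂ × ℂ)` the per-place
`(tr, det, u)` of the two blocks — constant on stable classes), has stable family `(F ∘ bzClassMap S) · stOrbFamH L νH β S` on `RegS S`; choosing `F` = (target ∕ family of `β`)
read through the class map gives the local pre-image.  This file is the multiplier half: the class map on the group (§2), its invariance and its chart reading (§2–§3),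
`C_c^∞`-closure (§4) and the orbital identity (§5).
* §1 (imported) ★ `ArchBouazizClassMap` (LH10-p01 (g5), p851469): `bzClassMap S c` — the per-place class data `(tr γ_w(c), det γ_w(c), e^{i c_{w,1}})_w` of a chart point,
  `BzLocalized Ψ b ε`, flip ∕ shift ∕ `negXAt` invariance, continuity.
* §2 `bzClassH L k` — the same data read on the group: `w ↦ (tr A_w, det A_w, (B_w)₀₀)` for `(A_w)_w = e_A k.1`, `(B_w)_w = e_B k.2` (★ `archPiEquivCM`); invariant under
  conjugation (`bzClassH_conj`: trace and determinant are class functions of `GL₂(ℂ)`, `GL₁(ℂ)` is abelian).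
* §3 `bzClassH_endoTorus : bzClassH L (endoTorus L S c) = bzClassMap S c` (★ `coe_endoBlock_of_mem ∕ _of_not_mem`, ★ `coe_endoCircle`: `tr diag(e^{x+iθ}, e^{−x+iθ}) =
  (eˣ+e⁻ˣ)e^{iθ}`, `det = e^{2iθ}`; `tr ½(a+b a−b; a−b a+b) = a + b`, `det = ab`), and its flip twin (★ `bzClassMap_flipSet`: flipping compact places permutes the two eigenvalues).
* §4 **`ArchSmooth₂.classMul`**: `ArchSmooth₂ L fH → ArchSmooth₂ L (fun k => F (bzClassH L k) * fH k)` for `F : (W → ℂ × ℂ × ℂ) → ℂ` of class `C^∞` — the ambient witness is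
  `(F ∘ cl_amb) · Θ` with `Θ` the `C^∞` lift of ★ `exists_contDiff_hasCompactSupport_of_isArchSmooth` and `cl_amb` the polynomial `(tr, det, entry)` of the pattern
  `ι_∞(a, b) = (a₀₀ 0 a₀₁; 0 b 0; a₁₀ 0 a₁₁)` (★ `coe_endoEmbArch_eq`); right-exp-smoothness by ★ `isArchSmooth_of_contDiff_slice`.
* §5 **`chartOrbH_classMul`**: `chartOrbH L νH S (fun k => F (bzClassH L k) * fH k) c = F (bzClassMap S c) * chartOrbH L νH S fH c` (EVERY `c`: the integrand is
  `F(cl_H(y γ y⁻¹)) · fH(y γ y⁻¹) = F(cl_H γ) · fH(…)`, ★ `descConj_mk`, `integral_const_mul`), hence `stableSum_chartOrbH_classMul` and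
  **`stOrbFamH_classMul_of_mem_regS`**: `stOrbFamH L νH ((F ∘ bzClassH L) · fH) S c = F (bzClassMap S c) * stOrbFamH L νH fH S c` for `c ∈ RegS S`; packaged as the
  (Σ-MULT) organ text of ★ `bouazizSurjOfForward_of_parts` (p851480): **`exists_archSmooth₂_stOrbFamH_eq_classMul`**.
HONEST LABEL: L3′ stays XL∕PRINT-labelled ((Σ5) PRINT, RULING #23) until paid; HC_CM is proved only modulo the 7 printed citations (2 remaining: hLiu418 = stmt-HodgeConjecture-24832,
h413 = stmt-HodgeConjecture-24833) until rung 0 closes; this file is measure∕calculus plumbing and pays nothing by itself.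

## References
* [Bouaziz1994IntegralesOrbitales] A. Bouaziz, *Intégrales orbitales sur les groupes de Lie réductifs*, Ann. Sci. ÉNS (4) 27 (1994) 573–609, §2.3 p. 578 (invariant
  functions and partitions of unity), §5.1 p. 588.
* [Varadarajan1989] V. S. Varadarajan, *An Introduction to Harmonic Analysis on Semisimple Lie Groups*, Cambridge Stud. Adv. Math. 16 (1989), §6 p. 229.
* [Rogawski1990] J. D. Rogawski, *Automorphic Representations of Unitary Groups in Three Variables*, Ann. of Math. Stud. 123 (1990), §3.6 p. 31, §4.1 (4.1.1) p. 39, §8.2 p. 122.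
-/

set_option autoImplicit false

noncomputable section

open MeasureTheory NumberField NumberField.InfinitePlace NumberField.mixedEmbedding Complex Set Function
open Literature.NumberTheory.Automorphic Literature.NumberTheory.Automorphic.UnitaryGroup Literature.NumberTheory.Automorphic.ArchCartan
open Literature.MeasureTheory.Group
open scoped Classical MatrixGroups Matrix ContDiff

namespace Literature.NumberTheory.Rogawski1990

/-! ## §2 The class map on the group `H_∞` -/

section ClassH

variable (L : Type) [Field L] [NumberField L] [IsCMField L]

/-- **The CLASS MAP on `H_∞ = U(Φ₂)(L ⊗ ℝ) × U(Φ₁)(L ⊗ ℝ)`**: `k ↦ (tr A_w, det A_w, (B_w)₀₀)_w` where `(A_w)_w` are the place components of `k.1` and `(B_w)_w` those of `k.2`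
(★ `archPiEquivCM`).  A polynomial in the matrix entries, constant on conjugacy classes (§2) and on stable classes (its value at every chart point is ★ `bzClassMap`, §3).
[cite: Bouaziz1994IntegralesOrbitales, §2.3 p. 578] [cite: Rogawski1990, §3.6 p. 31; §8.2 p. 122] -/
def bzClassH
    (k : ↥(arch (↥(maximalRealSubfield L)) L (IsCMField.complexConj L) 2 (Matrix.of fun i j : Fin 2 => if i.val + j.val + 1 = 2 then (1 : L) else 0)) ×
      ↥(arch (↥(maximalRealSubfield L)) L (IsCMField.complexConj L) 1 (Matrix.of fun i j : Fin 1 => if i.val + j.val + 1 = 1 then (1 : L) else 0)))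
    (w : {w : InfinitePlace L // IsComplex w}) : ℂ × ℂ × ℂ :=
  ((((archPiEquivCM 2 L (Matrix.of fun i j : Fin 2 => if i.val + j.val + 1 = 2 then (1 : L) else 0) k.1 w : GL (Fin 2) ℂ) : Matrix (Fin 2) (Fin 2) ℂ)).trace,
    (((archPiEquivCM 2 L (Matrix.of fun i j : Fin 2 => if i.val + j.val + 1 = 2 then (1 : L) else 0) k.1 w : GL (Fin 2) ℂ) : Matrix (Fin 2) (Fin 2) ℂ)).det,
    (((archPiEquivCM 1 L (Matrix.of fun i j : Fin 1 => if i.val + j.val + 1 = 1 then (1 : L) else 0) k.2 w : GL (Fin 1) ℂ) : Matrix (Fin 1) (Fin 1) ℂ)) 0 0)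

/-- Unfolding of `bzClassH`. [cite: Rogawski1990, §3.6 p. 31] -/
theorem bzClassH_apply
    (k : ↥(arch (↥(maximalRealSubfield L)) L (IsCMField.complexConj L) 2 (Matrix.of fun i j : Fin 2 => if i.val + j.val + 1 = 2 then (1 : L) else 0)) ×
      ↥(arch (↥(maximalRealSubfield L)) L (IsCMField.complexConj L) 1 (Matrix.of fun i j : Fin 1 => if i.val + j.val + 1 = 1 then (1 : L) else 0)))
    (w : {w : InfinitePlace L // IsComplex w}) :
    bzClassH L k w =
      ((((archPiEquivCM 2 L (Matrix.of fun i j : Fin 2 => if i.val + j.val + 1 = 2 then (1 : L) else 0) k.1 w : GL (Fin 2) ℂ) : Matrix (Fin 2) (Fin 2) ℂ)).trace,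
        (((archPiEquivCM 2 L (Matrix.of fun i j : Fin 2 => if i.val + j.val + 1 = 2 then (1 : L) else 0) k.1 w : GL (Fin 2) ℂ) : Matrix (Fin 2) (Fin 2) ℂ)).det,
        (((archPiEquivCM 1 L (Matrix.of fun i j : Fin 1 => if i.val + j.val + 1 = 1 then (1 : L) else 0) k.2 w : GL (Fin 1) ℂ) : Matrix (Fin 1) (Fin 1) ℂ)) 0 0) :=
  rfl

/-- **The class map is a CLASS FUNCTION**: `bzClassH L (h * k * h⁻¹) = bzClassH L k` (trace and determinant are conjugation invariant on `GL₂(ℂ)`; `GL₁(ℂ)` is commutative).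
[cite: Bouaziz1994IntegralesOrbitales, §2.3 p. 578] -/
theorem bzClassH_conj
    (h k : ↥(arch (↥(maximalRealSubfield L)) L (IsCMField.complexConj L) 2 (Matrix.of fun i j : Fin 2 => if i.val + j.val + 1 = 2 then (1 : L) else 0)) ×
      ↥(arch (↥(maximalRealSubfield L)) L (IsCMField.complexConj L) 1 (Matrix.of fun i j : Fin 1 => if i.val + j.val + 1 = 1 then (1 : L) else 0))) :
    bzClassH L (h * k * h⁻¹) = bzClassH L k := by
  funext w
  rw [bzClassH_apply, bzClassH_apply]
  simp only [Prod.fst_mul, Prod.snd_mul, Prod.fst_inv, Prod.snd_inv, map_mul, map_inv, Pi.mul_apply, Pi.inv_apply, Subgroup.coe_mul, Subgroup.coe_inv,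
    Units.val_mul]
  generalize ((archPiEquivCM 2 L (Matrix.of fun i j : Fin 2 => if i.val + j.val + 1 = 2 then (1 : L) else 0) h.1 w :
      ↥(archLocal L 2 (Matrix.of fun i j : Fin 2 => if i.val + j.val + 1 = 2 then (1 : L) else 0) w)) : GL (Fin 2) ℂ) = A
  generalize ((archPiEquivCM 2 L (Matrix.of fun i j : Fin 2 => if i.val + j.val + 1 = 2 then (1 : L) else 0) k.1 w :
      ↥(archLocal L 2 (Matrix.of fun i j : Fin 2 => if i.val + j.val + 1 = 2 then (1 : L) else 0) w)) : GL (Fin 2) ℂ) = B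
  generalize ((archPiEquivCM 1 L (Matrix.of fun i j : Fin 1 => if i.val + j.val + 1 = 1 then (1 : L) else 0) h.2 w :
      ↥(archLocal L 1 (Matrix.of fun i j : Fin 1 => if i.val + j.val + 1 = 1 then (1 : L) else 0) w)) : GL (Fin 1) ℂ) = C
  generalize ((archPiEquivCM 1 L (Matrix.of fun i j : Fin 1 => if i.val + j.val + 1 = 1 then (1 : L) else 0) k.2 w :
      ↥(archLocal L 1 (Matrix.of fun i j : Fin 1 => if i.val + j.val + 1 = 1 then (1 : L) else 0) w)) : GL (Fin 1) ℂ) = D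
  -- `1 × 1` matrices commute
  have hcomm : ∀ (a b : Matrix (Fin 1) (Fin 1) ℂ), a * b = b * a := fun a b => by
    ext i j; fin_cases i; fin_cases j; simp [Matrix.mul_apply, mul_comm]
  simp only [Prod.mk.injEq]
  refine ⟨Matrix.trace_units_conj A (B : Matrix (Fin 2) (Fin 2) ℂ), Matrix.det_units_conj A (B : Matrix (Fin 2) (Fin 2) ℂ), ?_⟩
  rw [hcomm (C : Matrix (Fin 1) (Fin 1) ℂ) (D : Matrix (Fin 1) (Fin 1) ℂ), mul_assoc, Units.mul_inv, mul_one]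

end ClassH

/-! ## §3 The class map at the chart points -/

section Chart

variable (L : Type) [Field L] [NumberField L] [IsCMField L]

/-- **THE CLASS OF A CHART POINT**: `bzClassH L (endoTorus L S c) = bzClassMap S c` — at a split place `tr diag(e^{x+iθ}, e^{−x+iθ}) = (eˣ + e⁻ˣ)e^{iθ}`, `det = e^{2iθ}`;
at a compact place `tr ½(a+b  a−b; a−b  a+b) = a + b`, `det = ab` (`a = e^{i c_{w,0}}`, `b = e^{i c_{w,2}}`); the `U(Φ₁)`-entry is `e^{i c_{w,1}}` (★ `coe_endoBlock_of_mem`,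
★ `coe_endoBlock_of_not_mem`, ★ `coe_endoCircle`). [cite: Rogawski1990, §3.6 p. 31; §8.2 p. 122] [cite: Shelstad1979, §4 p. 22] -/
theorem bzClassH_endoTorus (S : Finset {w : InfinitePlace L // IsComplex w}) (c : {w : InfinitePlace L // IsComplex w} → Fin 3 → ℝ) :
    bzClassH L (endoTorus L S c) = bzClassMap S c := by
  funext w
  rw [bzClassH_apply, archPiEquivCM_endoTorus_fst, archPiEquivCM_endoTorus_snd, coe_endoCircle, Matrix.diagonal_apply_eq]
  by_cases hw : w ∈ S
  · rw [coe_endoBlock_of_mem L c hw, bzClassMap_of_mem hw, Matrix.trace_fin_two_of, Matrix.det_fin_two_of]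
    simp only [Prod.mk.injEq]
    refine ⟨?_, ?_, trivial⟩
    · rw [Circle.coe_exp, Complex.exp_add, Complex.exp_add, Complex.ofReal_add, Complex.ofReal_exp, Complex.ofReal_exp, Complex.ofReal_neg]
      ring
    · rw [mul_zero, sub_zero, ← Complex.exp_add, Circle.coe_exp, sq, ← Complex.exp_add]
      congr 1
      ring
  · rw [coe_endoBlock_of_not_mem L c hw, bzClassMap_of_not_mem hw, Matrix.trace_fin_two_of, Matrix.det_fin_two_of]
    simp only [Prod.mk.injEq]
    exact ⟨by ring, by ring, trivial⟩

/-- The class of the chart point of a flipped coordinate is the class of the original one (★ `bzClassMap_flipSet`). [cite: Shelstad1979, §4 p. 23] -/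
theorem bzClassH_endoTorus_flipSet {S T : Finset {w : InfinitePlace L // IsComplex w}} (hT : ∀ w ∈ T, w ∉ S) (c : {w : InfinitePlace L // IsComplex w} → Fin 3 → ℝ) :
    bzClassH L (endoTorus L S (flipSet T c)) = bzClassMap S c := by
  rw [bzClassH_endoTorus, bzClassMap_flipSet S hT]

end Chart

/-! ## §4 `C_c^∞(H_∞)` is stable under multiplication by smooth class functions -/

section Mul

variable (L : Type) [Field L] [NumberField L] [IsCMField L]

-- the scoped `ℓ^∞`-operator norm on `M₃(L ⊗ ℝ)` (the one through which ★ `IsArchSmooth` is defined)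
open scoped Matrix.Norms.Operator

set_option backward.isDefEq.respectTransparency false in
/-- **THE CLASS-FUNCTION MULTIPLIER PRESERVES `C_c^∞(H_∞)`**: for `fH ∈ ArchSmooth₂ L` and `F : (W → ℂ × ℂ × ℂ) → ℂ` of class `C^∞`, the product
`k ↦ F (bzClassH L k) · fH k` is `ArchSmooth₂ L`.  Witness on `GL₃(L ⊗ ℝ)`: `(F ∘ cl_amb ∘ val) · φ` with `φ` the witness of `fH`, `Θ` its `C^∞` ambient lift
(★ `exists_contDiff_hasCompactSupport_of_isArchSmooth`) and `cl_amb(X)_w = (X₀₀ + X₂₂, X₀₀X₂₂ − X₀₂X₂₀, X₁₁)_w` the `(tr, det, entry)` of the pattern `ι_∞(a,b) = (a₀₀ 0 a₀₁; 0 b 0; a₁₀ 0 a₁₁)`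
(★ `coe_endoEmbArch_eq`): continuous, support inside that of `φ`, smooth along `X ↦ y · exp X` (★ `contDiff_exp_matrix_mixedSpace`).
[cite: Bouaziz1994IntegralesOrbitales, §2.3 p. 578] [cite: BorelJacquet1979, §4.1] -/
theorem ArchSmooth₂.classMul
    {fH : ↥(arch (↥(maximalRealSubfield L)) L (IsCMField.complexConj L) 2 (Matrix.of fun i j : Fin 2 => if i.val + j.val + 1 = 2 then (1 : L) else 0)) ×
        ↥(arch (↥(maximalRealSubfield L)) L (IsCMField.complexConj L) 1 (Matrix.of fun i j : Fin 1 => if i.val + j.val + 1 = 1 then (1 : L) else 0)) → ℂ}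
    (hfH : ArchSmooth₂ L fH) {F : ({w : InfinitePlace L // IsComplex w} → ℂ × ℂ × ℂ) → ℂ} (hF : ContDiff ℝ ∞ F) :
    ArchSmooth₂ L (fun k => F (bzClassH L k) * fH k) := by
  obtain ⟨φ, hφc, hφs, hφsm, hφa⟩ := hfH
  obtain ⟨Θ, hΘ, -, -, hΘφ⟩ := exists_contDiff_hasCompactSupport_of_isArchSmooth φ hφs hφsm
  -- the ambient class map of the pattern
  obtain ⟨cl, hcl⟩ : ∃ cl : Matrix (Fin 3) (Fin 3) (mixedSpace L) → ({w : InfinitePlace L // IsComplex w} → ℂ × ℂ × ℂ),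
      cl = fun X w => ((X 0 0).2 w + (X 2 2).2 w, (X 0 0).2 w * (X 2 2).2 w - (X 0 2).2 w * (X 2 0).2 w, (X 1 1).2 w) := ⟨_, rfl⟩
  have hclC : ContDiff ℝ ∞ cl := by
    rw [hcl]
    exact contDiff_pi.2 fun w => ((contDiff_apply_snd_apply L 0 0 w).add (contDiff_apply_snd_apply L 2 2 w)).prodMk
      ((((contDiff_apply_snd_apply L 0 0 w).mul (contDiff_apply_snd_apply L 2 2 w)).sub
        ((contDiff_apply_snd_apply L 0 2 w).mul (contDiff_apply_snd_apply L 2 0 w))).prodMk (contDiff_apply_snd_apply L 1 1 w))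
  -- on `ι_∞(H_∞)` the ambient class map IS `bzClassH`
  have hclass : ∀ k : ↥(arch (↥(maximalRealSubfield L)) L (IsCMField.complexConj L) 2 (Matrix.of fun i j : Fin 2 => if i.val + j.val + 1 = 2 then (1 : L) else 0)) ×
        ↥(arch (↥(maximalRealSubfield L)) L (IsCMField.complexConj L) 1 (Matrix.of fun i j : Fin 1 => if i.val + j.val + 1 = 1 then (1 : L) else 0)),
      cl ((endoEmbArch L k).val : Matrix (Fin 3) (Fin 3) (mixedSpace L)) = bzClassH L k := fun k => by
    funext w
    rw [hcl, bzClassH_apply, coe_endoEmbArch_eq, Matrix.trace_fin_two, Matrix.det_fin_two]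
    simp only [Matrix.of_apply, Matrix.cons_val', Matrix.cons_val_zero, Matrix.cons_val_one, Matrix.cons_val_two, Matrix.empty_val', Matrix.cons_val_fin_one,
      Matrix.head_cons, Matrix.tail_cons, Matrix.head_fin_const]
    rw [snd_coe_fst_apply L k w 0 0, snd_coe_fst_apply L k w 1 1, snd_coe_fst_apply L k w 0 1, snd_coe_fst_apply L k w 1 0, snd_coe_snd_apply L k w]
  refine ⟨fun g => F (cl (g : Matrix (Fin 3) (Fin 3) (mixedSpace L))) * φ g, ?_, hφs.mul_left, fun y => ?_, fun k => ?_⟩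
  · exact (hF.continuous.comp (hclC.continuous.comp Units.continuous_val)).mul hφc
  · -- Mathlib idiom (Mathlib/Algebra/Lie/OfAssociative.lean): the Lie structure on `M₃(L ⊗ ℝ)` through which ★ `archGroupGL` speaks
    letI : LieRing (Matrix (Fin 3) (Fin 3) (mixedSpace L)) := LieRing.ofAssociativeRing
    letI : LieAlgebra ℝ (Matrix (Fin 3) (Fin 3) (mixedSpace L)) := LieAlgebra.ofAssociativeAlgebra
    show ContDiff ℝ ∞ fun X : (archGroupGL 3 L).lie.toSubmodule =>
      F (cl (((y : GL (Fin 3) (mixedSpace L)) * expGL (X : Matrix (Fin 3) (Fin 3) (mixedSpace L)) : GL (Fin 3) (mixedSpace L)) : Matrix (Fin 3) (Fin 3) (mixedSpace L))) *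
        φ ((y : GL (Fin 3) (mixedSpace L)) * expGL (X : Matrix (Fin 3) (Fin 3) (mixedSpace L)))
    have hval : ContDiff ℝ ∞ fun X : (archGroupGL 3 L).lie.toSubmodule => (X : Matrix (Fin 3) (Fin 3) (mixedSpace L)) := (archGroupGL 3 L).lie.toSubmodule.subtypeL.contDiff
    have h : (fun X : (archGroupGL 3 L).lie.toSubmodule =>
        F (cl (((y : GL (Fin 3) (mixedSpace L)) * expGL (X : Matrix (Fin 3) (Fin 3) (mixedSpace L)) : GL (Fin 3) (mixedSpace L)) : Matrix (Fin 3) (Fin 3) (mixedSpace L))) *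
          φ ((y : GL (Fin 3) (mixedSpace L)) * expGL (X : Matrix (Fin 3) (Fin 3) (mixedSpace L)))) =
        fun X : (archGroupGL 3 L).lie.toSubmodule =>
          F (cl (((y : GL (Fin 3) (mixedSpace L)) : Matrix (Fin 3) (Fin 3) (mixedSpace L)) * NormedSpace.exp (X : Matrix (Fin 3) (Fin 3) (mixedSpace L)))) *
            Θ (((y : GL (Fin 3) (mixedSpace L)) : Matrix (Fin 3) (Fin 3) (mixedSpace L)) * NormedSpace.exp (X : Matrix (Fin 3) (Fin 3) (mixedSpace L))) := by
      funext X; rw [hΘφ, Units.val_mul, coe_expGL]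
    rw [h]
    have hexp : ContDiff ℝ ∞ fun X : (archGroupGL 3 L).lie.toSubmodule =>
        ((y : GL (Fin 3) (mixedSpace L)) : Matrix (Fin 3) (Fin 3) (mixedSpace L)) * NormedSpace.exp (X : Matrix (Fin 3) (Fin 3) (mixedSpace L)) :=
      contDiff_const.mul (contDiff_exp_matrix_mixedSpace.comp hval)
    exact (hF.comp (hclC.comp hexp)).mul (hΘ.comp hexp)
  · show F (bzClassH L k) * fH k = F (cl ((endoEmbArch L k).val : Matrix (Fin 3) (Fin 3) (mixedSpace L))) * φ ((endoEmbArch L k).val)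
    rw [hclass, hφa]

end Mul

/-! ## §5 The orbital identity: a class function comes out of the chart orbital functional -/

section Orb

variable (L : Type) [Field L] [NumberField L] [IsCMField L]
  [MeasurableSpace (↥(arch (↥(maximalRealSubfield L)) L (IsCMField.complexConj L) 2 (Matrix.of fun i j : Fin 2 => if i.val + j.val + 1 = 2 then (1 : L) else 0)) ×
      ↥(arch (↥(maximalRealSubfield L)) L (IsCMField.complexConj L) 1 (Matrix.of fun i j : Fin 1 => if i.val + j.val + 1 = 1 then (1 : L) else 0)))]
  [BorelSpace (↥(arch (↥(maximalRealSubfield L)) L (IsCMField.complexConj L) 2 (Matrix.of fun i j : Fin 2 => if i.val + j.val + 1 = 2 then (1 : L) else 0)) ×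
      ↥(arch (↥(maximalRealSubfield L)) L (IsCMField.complexConj L) 1 (Matrix.of fun i j : Fin 1 => if i.val + j.val + 1 = 1 then (1 : L) else 0)))]
  (νH : Measure (↥(arch (↥(maximalRealSubfield L)) L (IsCMField.complexConj L) 2 (Matrix.of fun i j : Fin 2 => if i.val + j.val + 1 = 2 then (1 : L) else 0)) ×
      ↥(arch (↥(maximalRealSubfield L)) L (IsCMField.complexConj L) 1 (Matrix.of fun i j : Fin 1 => if i.val + j.val + 1 = 1 then (1 : L) else 0))))
  [IsFiniteMeasureOnCompacts νH] [νH.IsMulRightInvariant]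

/-- **A CLASS FUNCTION COMES OUT OF THE CHART ORBITAL FUNCTIONAL** — `chartOrbH L νH S ((F ∘ bzClassH L) · fH) c = F (bzClassMap S c) · chartOrbH L νH S fH c` at EVERY
coordinate `c`: the integrand on `H_∞ ⧸ T_S` is `F(cl_H(y γ y⁻¹)) · fH(y γ y⁻¹) = F(cl_H γ) · fH(y γ y⁻¹)` (★ `descConj_mk`, `bzClassH_conj`), `γ = endoTorus S c` has class
`bzClassMap S c` (`bzClassH_endoTorus`), and the constant leaves the integral. [cite: Bouaziz1994IntegralesOrbitales, §2.3 p. 578; §5.1 p. 588] [cite: Rogawski1990, §8.2 p. 122] -/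
theorem chartOrbH_classMul (S : Finset {w : InfinitePlace L // IsComplex w})
    (fH : ↥(arch (↥(maximalRealSubfield L)) L (IsCMField.complexConj L) 2 (Matrix.of fun i j : Fin 2 => if i.val + j.val + 1 = 2 then (1 : L) else 0)) ×
      ↥(arch (↥(maximalRealSubfield L)) L (IsCMField.complexConj L) 1 (Matrix.of fun i j : Fin 1 => if i.val + j.val + 1 = 1 then (1 : L) else 0)) → ℂ)
    (F : ({w : InfinitePlace L // IsComplex w} → ℂ × ℂ × ℂ) → ℂ) (c : {w : InfinitePlace L // IsComplex w} → Fin 3 → ℝ) :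
    chartOrbH L νH S (fun k => F (bzClassH L k) * fH k) c = F (bzClassMap S c) * chartOrbH L νH S fH c := by
  rw [chartOrbH_def, chartOrbH_def]
  have hint : descConj (endoTorus L S c) (chartTorusH L S) (forall_mem_chartTorusH_comm L S c)
        (fun k : ↥(arch (↥(maximalRealSubfield L)) L (IsCMField.complexConj L) 2 (Matrix.of fun i j : Fin 2 => if i.val + j.val + 1 = 2 then (1 : L) else 0)) ×
          ↥(arch (↥(maximalRealSubfield L)) L (IsCMField.complexConj L) 1 (Matrix.of fun i j : Fin 1 => if i.val + j.val + 1 = 1 then (1 : L) else 0)) => F (bzClassH L k) * fH k) =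
      fun y => F (bzClassMap S c) * descConj (endoTorus L S c) (chartTorusH L S) (forall_mem_chartTorusH_comm L S c) fH y := by
    funext y
    induction y using QuotientGroup.induction_on with
    | H g => rw [descConj_mk, descConj_mk, bzClassH_conj, bzClassH_endoTorus]
  rw [hint, integral_const_mul]
  ring

/-- The class function comes out of the stable sum of chart functionals (flips do not change the class, ★ `bzClassMap_flipSet`). [cite: Rogawski1990, §4.1 (4.1.1) p. 39] -/
theorem stableSum_chartOrbH_classMul (S : Finset {w : InfinitePlace L // IsComplex w})
    (fH : ↥(arch (↥(maximalRealSubfield L)) L (IsCMField.complexConj L) 2 (Matrix.of fun i j : Fin 2 => if i.val + j.val + 1 = 2 then (1 : L) else 0)) ×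
      ↥(arch (↥(maximalRealSubfield L)) L (IsCMField.complexConj L) 1 (Matrix.of fun i j : Fin 1 => if i.val + j.val + 1 = 1 then (1 : L) else 0)) → ℂ)
    (F : ({w : InfinitePlace L // IsComplex w} → ℂ × ℂ × ℂ) → ℂ) (c : {w : InfinitePlace L // IsComplex w} → Fin 3 → ℝ) :
    stableSum S (chartOrbH L νH S (fun k => F (bzClassH L k) * fH k)) c = F (bzClassMap S c) * stableSum S (chartOrbH L νH S fH) c := by
  rw [stableSum_def, stableSum_def, Finset.mul_sum]
  refine Finset.sum_congr rfl fun T hT => ?_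
  rw [chartOrbH_classMul, bzClassMap_flipSet S (not_mem_of_mem_powerset_sdiff hT)]

/-- **THE STABLE ORBITAL FAMILY OF `(F ∘ cl_H) · fH` IS `(F ∘ bzClassMap S) · stOrbFamH L νH fH S` ON THE REGULAR SET** (★ `stOrbFamH_of_mem_regS`: there the family is
literally `R_S · Σ_T chartOrbH ∘ flipSet T`).  The (Σ4) «class-function multiplier» identity of the SURJ-OF-FORWARD road. [cite: Bouaziz1994IntegralesOrbitales, §5.1 p. 588]
[cite: Varadarajan1989, §6 p. 229] [cite: Shelstad1979, §4 p. 22] -/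
theorem stOrbFamH_classMul_of_mem_regS
    (fH : ↥(arch (↥(maximalRealSubfield L)) L (IsCMField.complexConj L) 2 (Matrix.of fun i j : Fin 2 => if i.val + j.val + 1 = 2 then (1 : L) else 0)) ×
      ↥(arch (↥(maximalRealSubfield L)) L (IsCMField.complexConj L) 1 (Matrix.of fun i j : Fin 1 => if i.val + j.val + 1 = 1 then (1 : L) else 0)) → ℂ)
    (F : ({w : InfinitePlace L // IsComplex w} → ℂ × ℂ × ℂ) → ℂ) (S : Finset {w : InfinitePlace L // IsComplex w})
    {c : {w : InfinitePlace L // IsComplex w} → Fin 3 → ℝ} (hc : c ∈ RegS S) :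
    stOrbFamH L νH (fun k => F (bzClassH L k) * fH k) S c = F (bzClassMap S c) * stOrbFamH L νH fH S c := by
  rw [stOrbFamH_of_mem_regS L νH _ S hc, stOrbFamH_of_mem_regS L νH fH S hc, ← stableSum_def, ← stableSum_def, stableSum_chartOrbH_classMul]
  ring

/-- The same as an `EqOn` on `RegS S`. [cite: Bouaziz1994IntegralesOrbitales, §5.1 p. 588] -/
theorem stOrbFamH_classMul_eqOn
    (fH : ↥(arch (↥(maximalRealSubfield L)) L (IsCMField.complexConj L) 2 (Matrix.of fun i j : Fin 2 => if i.val + j.val + 1 = 2 then (1 : L) else 0)) ×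
      ↥(arch (↥(maximalRealSubfield L)) L (IsCMField.complexConj L) 1 (Matrix.of fun i j : Fin 1 => if i.val + j.val + 1 = 1 then (1 : L) else 0)) → ℂ)
    (F : ({w : InfinitePlace L // IsComplex w} → ℂ × ℂ × ℂ) → ℂ) (S : Finset {w : InfinitePlace L // IsComplex w}) :
    Set.EqOn (stOrbFamH L νH (fun k => F (bzClassH L k) * fH k) S) (fun c => F (bzClassMap S c) * stOrbFamH L νH fH S c) (RegS S) :=
  fun _ hc => stOrbFamH_classMul_of_mem_regS L νH fH F S hc

/-- **(Σ-MULT) ORGAN OF THE SURJ-OF-FORWARD ASSEMBLY, PAID** — the `hmult` hypothesis of ★ `bouazizSurjOfForward_of_parts` (LH10-p01 (g5), p851480) token for token after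
its frame: for `F` smooth on the class space and `fH ∈ C_c^∞(H_∞)` there is `fH′ ∈ C_c^∞(H_∞)` — namely `(F ∘ bzClassH L) · fH` — with
`stOrbFamH L νH fH′ S c = F (bzClassMap S c) · stOrbFamH L νH fH S c` at every regular chart point (Bouaziz's `J_G(χφ) = χ·J_G(φ)` for invariant `χ`).
[cite: Bouaziz1994IntegralesOrbitales, §5.1 p. 588] [cite: Rogawski1990, §4.1 (4.1.1) p. 39] -/
theorem exists_archSmooth₂_stOrbFamH_eq_classMul
    (F : ({w : InfinitePlace L // IsComplex w} → ℂ × ℂ × ℂ) → ℂ) (hF : ContDiff ℝ ∞ F)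
    (fH : ↥(arch (↥(maximalRealSubfield L)) L (IsCMField.complexConj L) 2 (Matrix.of fun i j : Fin 2 => if i.val + j.val + 1 = 2 then (1 : L) else 0)) ×
      ↥(arch (↥(maximalRealSubfield L)) L (IsCMField.complexConj L) 1 (Matrix.of fun i j : Fin 1 => if i.val + j.val + 1 = 1 then (1 : L) else 0)) → ℂ)
    (hfH : ArchSmooth₂ L fH) :
    ∃ fH' : ↥(arch (↥(maximalRealSubfield L)) L (IsCMField.complexConj L) 2 (Matrix.of fun i j : Fin 2 => if i.val + j.val + 1 = 2 then (1 : L) else 0)) ×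
        ↥(arch (↥(maximalRealSubfield L)) L (IsCMField.complexConj L) 1 (Matrix.of fun i j : Fin 1 => if i.val + j.val + 1 = 1 then (1 : L) else 0)) → ℂ,
      ArchSmooth₂ L fH' ∧ ∀ (S : Finset {w : InfinitePlace L // IsComplex w}) (c : {w : InfinitePlace L // IsComplex w} → Fin 3 → ℝ), c ∈ RegS S →
        stOrbFamH L νH fH' S c = F (bzClassMap S c) * stOrbFamH L νH fH S c :=
  ⟨fun k => F (bzClassH L k) * fH k, hfH.classMul L hF, fun S _ hc => stOrbFamH_classMul_of_mem_regS L νH fH F S hc⟩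

end Orb

end Literature.NumberTheory.Rogawski1990

end
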